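import Mathlib.LinearAlgebra.Matrix.Permanent
import Mathlib.GroupTheory.Perm.Fin
import HarnessLib

/-!
# Laplace (cofactor) expansion of the permanent along a row or a column

Mathlib's `Matrix.permanent` (`per M = ∑_σ ∏_i M (σ i) i`, H. J. Ryser's definition) comes with
very little API (transposition, row/column permutations, scaling). This file supplies the
permanent twins of Mathlib's `Matrix.det_succ_row_zero` / `det_succ_column_zero` /
`det_succ_row` / `det_succ_column` (Laplace expansion along one row or one column of an
`(n+1) × (n+1)` matrix; the same statements without signs) and the invariance of the permanent
under re-indexing along an equivalence of index types. These are the elementary identities of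
H. Minc, *Permanents* (1978), §1.1–§1.2 ("the permanent ... may be expanded by any row or
column"); they are used by the algebraic-complexity files on Valiant's completeness theorem
(`Literature/Computability/AlgebraicComplexity/PermanentUniversality.lean`).

* `Matrix.permanent_submatrix_equiv` — `per (M.submatrix e e) = per M` for `e : m ≃ n`.
* `Matrix.permanent_eq_sum_row_zero` — expansion along row `0` (the column-`0` expansion of the
  transpose is carried out inside its proof).
* `Matrix.permanent_eq_sum_row`, `Matrix.permanent_eq_sum_column` — expansion along row `i` /
  column `j`.
* `Matrix.permanent_eq_sum_row_subset` — the same along a row supported in a set `s` of columns.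

## Design notes

* All statements are deliberate dot-notation extensions of Mathlib's `Matrix` namespace (Mathlib
  has no such lemmas; searched `permanent_succ`, `permanent_row`, `permanent_submatrix`).
* The column-`0` expansion is already in the tree as `Matrix.permanent_succ_column_zero`
  (`Literature/Computability/Complexity/OccurrenceObstructionsFresh.lean`), but that file imports
  the geometric-complexity stack (plethysm stability); to keep this toolkit Mathlib-only the same
  argument (`Finset.univ_perm_fin_succ`, `Fin.succAbove_cycleRange`) is replayed inside the proof
  of `Matrix.permanent_eq_sum_row_zero` rather than imported, and no separate column-`0` lemma is
  declared here (the general `Matrix.permanent_eq_sum_column` covers it).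
* Everything holds over a commutative semiring.

## References

* H. Minc, *Permanents*, Encyclopedia of Mathematics and its Applications 6, Addison-Wesley
  1978, §1.1–§1.2. (Not held; the statements are elementary and fully proved here.)
-/

namespace Matrix

open Equiv Finset

variable {R : Type*} [CommSemiring R]

/-- **Re-indexing invariance**: for an equivalence `e : m ≃ n` of index types,
`per (M.submatrix e e) = per M` (substitute `σ ↦ e⁻¹ σ e` in the defining sum). [folklore] -/
theorem permanent_submatrix_equiv {m n : Type*} [DecidableEq m] [Fintype m] [DecidableEq n]
    [Fintype n] (e : m ≃ n) (M : Matrix n n R) : (M.submatrix e e).permanent = M.permanent := by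
  unfold permanent
  refine Fintype.sum_equiv e.permCongr _ _ fun σ => ?_
  refine Fintype.prod_equiv e _ _ fun i => ?_
  simp [Equiv.permCongr_apply]

/-- **Laplace expansion of the permanent along row `0`**:
`per A = ∑ j, A 0 j · per (A with row 0 and column j deleted)` (Minc 1978, §1.2). The proof
expands the transpose along column `0` exactly as Mathlib's `Matrix.det_succ_column_zero`
(decompose `S_{n+1}` by the image of `0`, `Finset.univ_perm_fin_succ`, and realign the embedding
of `S_n` by the cycle `(0 1 … i)`, `Fin.succAbove_cycleRange`), without signs. [folklore] -/
theorem permanent_eq_sum_row_zero {n : ℕ} (A : Matrix (Fin n.succ) (Fin n.succ) R) :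
    permanent A = ∑ j : Fin n.succ, A 0 j * permanent (A.submatrix Fin.succ j.succAbove) := by
  -- expansion along column `0`, for every matrix `B` (applied to `B = Aᵀ` below)
  have hcol : ∀ B : Matrix (Fin n.succ) (Fin n.succ) R,
      permanent B = ∑ i : Fin n.succ, B i 0 * permanent (B.submatrix i.succAbove Fin.succ) := by
    intro B
    rw [Matrix.permanent, Finset.univ_perm_fin_succ, ← Finset.univ_product_univ]
    simp only [Finset.sum_map, Equiv.toEmbedding_apply, Finset.sum_product]
    refine Finset.sum_congr rfl fun p _ => ?_
    have key : ∀ τ : Perm (Fin n), ∏ i, B (Perm.decomposeFin.symm (p, τ) i) i =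
        B p 0 * ∏ i, B (Equiv.swap 0 p (τ i).succ) i.succ := fun τ => by
      rw [Fin.prod_univ_succ, Perm.decomposeFin_symm_apply_zero]
      simp only [Perm.decomposeFin_symm_apply_succ]
    simp only [key, ← Finset.mul_sum]
    congr 1
    refine Fin.cases ?_ (fun i => ?_) p
    · simp only [Equiv.swap_self, Equiv.refl_apply, Matrix.permanent, submatrix_apply,
        Fin.succAbove_zero]
    · rw [← permanent_permute_cols i.cycleRange, Matrix.permanent]
      refine Finset.sum_congr rfl fun τ _ => Finset.prod_congr rfl fun j _ => ?_
      simp only [submatrix_apply, id, Fin.succAbove_cycleRange]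
  rw [← permanent_transpose, hcol]
  refine Finset.sum_congr rfl fun j _ => ?_
  rw [transpose_apply, ← permanent_transpose, transpose_submatrix, transpose_transpose]

/-- **Laplace expansion of the permanent along row `i`**:
`per A = ∑ j, A i j · per (A with row i and column j deleted)` (Minc 1978, §1.2: "the permanent
may be expanded by any row"; move row `i` to the top with the cycle `(0 1 … i)`, which does not
change the permanent, `Matrix.permanent_permute_cols`). [folklore] -/
theorem permanent_eq_sum_row {n : ℕ} (A : Matrix (Fin n.succ) (Fin n.succ) R) (i : Fin n.succ) :
    permanent A = ∑ j : Fin n.succ, A i j * permanent (A.submatrix i.succAbove j.succAbove) := by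
  rw [← permanent_permute_cols i.cycleRange⁻¹ A, permanent_eq_sum_row_zero]
  refine Finset.sum_congr rfl fun j _ => ?_
  rw [Matrix.submatrix_apply, submatrix_submatrix]
  simp [Equiv.Perm.inv_def, Function.comp_def]

/-- **Laplace expansion of the permanent along column `j`**:
`per A = ∑ i, A i j · per (A with row i and column j deleted)` (Minc 1978, §1.2; by
transposition from the row version). [folklore] -/
theorem permanent_eq_sum_column {n : ℕ} (A : Matrix (Fin n.succ) (Fin n.succ) R)
    (j : Fin n.succ) :
    permanent A = ∑ i : Fin n.succ, A i j * permanent (A.submatrix i.succAbove j.succAbove) := by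
  rw [← permanent_transpose, permanent_eq_sum_row _ j]
  refine Finset.sum_congr rfl fun i _ => ?_
  rw [← permanent_transpose, transpose_apply, transpose_submatrix, transpose_transpose]

/-- Laplace expansion along a row supported in a set of columns: if `A i j = 0` for `j ∉ s`
then `per A = ∑_{j ∈ s} A i j · per (A with row i and column j deleted)`. [folklore] -/
theorem permanent_eq_sum_row_subset {n : ℕ} (A : Matrix (Fin n.succ) (Fin n.succ) R)
    (i : Fin n.succ) (s : Finset (Fin n.succ)) (hs : ∀ j, j ∉ s → A i j = 0) :
    permanent A = ∑ j ∈ s, A i j * permanent (A.submatrix i.succAbove j.succAbove) := by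
  rw [permanent_eq_sum_row A i]
  symm
  refine Finset.sum_subset (Finset.subset_univ s) fun j _ hj => ?_
  rw [hs j hj, zero_mul]

end Matrix
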